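import Summits.ValiantsHypothesis.ValiantsHypothesis.Theorems.MonotoneRestorationOrbitRestorationQPValueOrbit
import Summits.ValiantsHypothesis.ValiantsHypothesis.Theses.MonotoneRestoration
import Literature.Computability.AlgebraicComplexity.OrbitClosureProofs
import Literature.Computability.AlgebraicComplexity.DawarWilsenach2025Thm71
import HarnessLib

/-!
# The crux `OrbitRestorationQP` in VALUE-ORBIT form; rigid supports; the permanent

Route MonotoneRestoration, crux `OrbitRestorationQP` (stmt-ValiantsHypothesis-18293), namespace
`Summit.ValiantsHypothesis.ValiantsHypothesis.Theorems.ValueOrbit`.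

Consequences of the value-orbit symmetrisation theorem (`…OrbitRestorationQPValueOrbit.lean`,
`ValueDerivation.exists_symmetric_of_valueDerivation`) for the square-symmetric setting of the crux
(`Γ = Sym(Fin n)` acting diagonally on the `n × n` variable matrix, constants `ℂ`):

* `qpOrbit_of_valueDerivation` — a diagonally invariant `f` with a value derivation all of whose values
  have orbits `≤ 2^((log₂ n + c)^c)` has a square-symmetric circuit of orbit size
  `≤ 2^((log₂ n + c + 3)^(c + 3))`;
* `orbitRestorationQP_of_valueOrbitQP` — **the crux follows from its VALUE-ORBIT form**: "every
  matrix-symmetric `VP` family has, at every `n`, SOME ordinary computation (any length) all of whose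
  intermediate values have quasi-polynomially bounded `Sym(Fin n)`-orbits" — a statement about ordinary
  circuits in which symmetric circuits no longer occur;
* `orbit_bounded_of_supported` / `qpOrbit_of_supportedDerivation` — **orbit width through rigid
  supports** (the director's lane, Dawar–Wilsenach Def. 6.1): if every value of the derivation is fixed by
  the pointwise stabiliser of `≤ k` indices, the symmetric circuit has orbit size `≤ (n+1)^(2k+4)`;
* `perPoly_valueOrbit_lb` — **calibration at the permanent** (Dawar–Wilsenach Thm 7.1, PROVED in the
  tree as `DawarWilsenach2025_thm71_holds`): every family of computations of `per_n` — of any length —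
  passes through values whose `Sym(Fin n)`-orbits are not `2^{o(n)}`.

Everything is proved.  The crux itself (a declared strict strengthening of VH) is not claimed.

## References
* A. Dawar, G. Wilsenach, *Symmetric arithmetic circuits*, ToC 21 (2025), §3.3, Def. 6.1, Thm. 7.1.
  [DawarWilsenach2025]
-/

noncomputable section

open scoped Classical

-- `Summit.ValiantsHypothesis.ValiantsHypothesis.…` is the tree's single-conjunct layout (Sub = Summit).
set_option linter.dupNamespace false

namespace Summit.ValiantsHypothesis.ValiantsHypothesis.Theorems

open HTerm

universe u v w

namespace ValueOrbit

open Literature.Computability.AlgebraicComplexity Filter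

/-! ### The square-symmetric setting -/

/-- The diagonal action in the tree's `ren` form: a matrix-symmetric polynomial is diagonally
invariant. [folklore] -/
theorem ren_eq_of_matrixSymmetric {n : ℕ} {f : MvPolynomial (Fin n × Fin n) ℂ}
    (h : ∀ σ τ : Equiv.Perm (Fin n), MvPolynomial.rename (fun p : Fin n × Fin n => (σ p.1, τ p.2)) f = f)
    (σ : Equiv.Perm (Fin n)) : ren σ f = f :=
  h σ σ

/-- The orbit of a variable `x_ij` under the diagonal action has at most `n · n` elements. [folklore] -/
theorem ncard_orbit_var_le (n : ℕ) (x : Fin n × Fin n) :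
    (Set.range fun σ : Equiv.Perm (Fin n) => σ • x).ncard ≤ n * n := by
  calc (Set.range fun σ : Equiv.Perm (Fin n) => σ • x).ncard
      ≤ (Set.univ : Set (Fin n × Fin n)).ncard := Set.ncard_le_ncard (Set.subset_univ _) (Set.toFinite _)
    _ = n * n := by rw [Set.ncard_univ, Nat.card_eq_fintype_card, Fintype.card_prod, Fintype.card_fin]

/-- Arithmetic: `2 ((L+c)^c + 2L + 2) ≤ (L + c + 3)^(c+3)`. [folklore] -/
theorem exp_arith (L c : ℕ) : 2 * ((L + c) ^ c + 2 * L + 2) ≤ (L + (c + 3)) ^ (c + 3) := by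
  set m := L + (c + 3) with hm
  have hm3 : 3 ≤ m := by omega
  have h1 : (L + c) ^ c ≤ m ^ c := Nat.pow_le_pow_left (by omega) c
  have h2 : 1 ≤ m ^ c := Nat.one_le_pow _ _ (by omega)
  have h3 : m ^ (c + 3) = m ^ c * (m * m * m) := by ring
  have h4 : 2 * L + 2 ≤ m * m := by nlinarith
  have h6 : m + 2 * (m * m) ≤ m * m * m := by nlinarith
  rw [h3]
  calc 2 * ((L + c) ^ c + 2 * L + 2) = 2 * (L + c) ^ c + 2 * (2 * L + 2) := by ring
    _ ≤ 2 * m ^ c + 2 * (m * m) := by gcongr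
    _ ≤ m ^ c * m + m ^ c * (2 * (m * m)) := by nlinarith
    _ = m ^ c * (m + 2 * (m * m)) := by ring
    _ ≤ m ^ c * (m * m * m) := Nat.mul_le_mul_left _ h6

/-- Arithmetic: `n · n ≤ 2^(2 log₂ n + 2)`. [folklore] -/
theorem sq_le_pow_log (n : ℕ) : n * n ≤ 2 ^ (2 * Nat.log 2 n + 2) := by
  have hL : n < 2 ^ (Nat.log 2 n + 1) := Nat.lt_pow_succ_log_self Nat.one_lt_two n
  calc n * n ≤ 2 ^ (Nat.log 2 n + 1) * 2 ^ (Nat.log 2 n + 1) := Nat.mul_le_mul hL.le hL.le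
    _ = 2 ^ (2 * Nat.log 2 n + 2) := by rw [← pow_add]; ring_nf

/-- **Quasi-polynomial value orbits give quasi-polynomial symmetric orbit size.**  A diagonally
`Sym(Fin n)`-invariant `f` over `ℂ` that is a value of a value derivation (any length) all of whose values
have orbits `≤ 2^((log₂ n + c)^c)` has a square-symmetric circuit of orbit size
`≤ 2^((log₂ n + c + 3)^(c+3))`. [folklore] -/
theorem qpOrbit_of_valueDerivation {n c : ℕ} (𝒟 : ValueDerivation ℂ (Fin n × Fin n))
    {f : MvPolynomial (Fin n × Fin n) ℂ} (hf : f ∈ 𝒟.S) (hfix : ∀ σ : Equiv.Perm (Fin n), ren σ f = f)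
    (hS : ∀ q ∈ 𝒟.S, (Set.range fun σ : Equiv.Perm (Fin n) => ren σ q).ncard ≤ 2 ^ ((Nat.log 2 n + c) ^ c)) :
    ∃ (G : Type) (_ : Fintype G) (C : LabelledArithCircuit ℂ (Fin n × Fin n) Unit G),
      C.IsSymmetric (Equiv.Perm (Fin n)) ∧ C.eval (C.output ()) = f ∧
        C.orbitSize (Equiv.Perm (Fin n)) ≤ 2 ^ ((Nat.log 2 n + (c + 3)) ^ (c + 3)) := by
  set L := Nat.log 2 n with hL
  set B := 2 ^ ((L + c) ^ c + 2 * L + 2) with hB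
  have hB1 : 1 ≤ B := Nat.one_le_two_pow
  have hX : ∀ x : Fin n × Fin n, (Set.range fun σ : Equiv.Perm (Fin n) => σ • x).ncard ≤ B := fun x =>
    (ncard_orbit_var_le n x).trans ((sq_le_pow_log n).trans (Nat.pow_le_pow_right (by norm_num) (by omega)))
  have hS' : ∀ q ∈ 𝒟.S, (Set.range fun σ : Equiv.Perm (Fin n) => ren σ q).ncard ≤ B := fun q hq =>
    (hS q hq).trans (Nat.pow_le_pow_right (by norm_num) (by omega))
  obtain ⟨G, inst, C, hC, hev, horb⟩ := 𝒟.exists_symmetric_of_valueDerivation hf hB1 hfix hX hS'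
  refine ⟨G, inst, C, hC, hev, horb.trans ?_⟩
  rw [hB, ← pow_add, ← two_mul]
  exact Nat.pow_le_pow_right (by norm_num) (exp_arith L c)

/-- **THE CRUX FOLLOWS FROM ITS VALUE-ORBIT FORM.**  If every matrix-symmetric `VP` family over `ℂ`
admits, for one constant `c` and every `n`, SOME value derivation of `f n` — an ordinary straight-line
computation of any length — all of whose intermediate VALUES have `Sym(Fin n)`-orbits (diagonal action)
of size `≤ 2^((log₂ n + c)^c)`, then `OrbitRestorationQP` holds.  (Symmetric circuits have disappeared
from the hypothesis: in orbit currency the price of symmetry is nil.) [folklore] -/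
theorem orbitRestorationQP_of_valueOrbitQP
    (h : ∀ f : (n : ℕ) → MvPolynomial (Fin n × Fin n) ℂ,
      (∀ (n : ℕ) (σ τ : Equiv.Perm (Fin n)),
        MvPolynomial.rename (fun p : Fin n × Fin n => (σ p.1, τ p.2)) (f n) = f n) →
      IsVPFamily f →
      ∃ c : ℕ, ∀ n : ℕ, ∃ 𝒟 : ValueDerivation ℂ (Fin n × Fin n), f n ∈ 𝒟.S ∧
        ∀ q ∈ 𝒟.S, (Set.range fun σ : Equiv.Perm (Fin n) => ren σ q).ncard ≤ 2 ^ ((Nat.log 2 n + c) ^ c)) :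
    Theses.MonotoneRestoration.OrbitRestorationQP := by
  intro f hsymm hVP
  obtain ⟨c, hc⟩ := h f hsymm hVP
  refine ⟨c + 3, fun n => ?_⟩
  obtain ⟨𝒟, hf, hS⟩ := hc n
  exact qpOrbit_of_valueDerivation 𝒟 hf (ren_eq_of_matrixSymmetric (hsymm n)) hS

/-! ### Orbit width through rigid supports -/

/-- **Supports bound orbits** (Dawar–Wilsenach Def. 6.1 for values): a polynomial fixed by the pointwise
stabiliser of a set `T` of indices has at most `(n+1)^|T|` diagonal translates. [folklore] -/
theorem orbit_bounded_of_supported {n : ℕ} {q : MvPolynomial (Fin n × Fin n) ℂ} {T : Finset (Fin n)}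
    (hT : ∀ σ : Equiv.Perm (Fin n), (∀ i ∈ T, σ i = i) → ren σ q = q) :
    (Set.range fun σ : Equiv.Perm (Fin n) => ren σ q).ncard ≤ (n + 1) ^ T.card := by
  have hagree : ∀ σ τ : Equiv.Perm (Fin n), (∀ i ∈ T, σ i = τ i) → ren σ q = ren τ q := by
    intro σ τ hστ
    have hfix : ren (τ⁻¹ * σ) q = q := hT (τ⁻¹ * σ) fun i hi => by
      rw [Equiv.Perm.mul_apply, hστ i hi]
      exact τ.symm_apply_apply i
    have := congrArg (ren τ) hfix
    rwa [← ren_mul, mul_inv_cancel_left] at this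
  refine (ncard_range_le_pow_of_agree T (fun σ : Equiv.Perm (Fin n) => ren σ q) hagree).trans ?_
  rw [Fintype.card_fin]
  exact Nat.pow_le_pow_left (Nat.le_succ n) _

/-- **Orbit width through rigid supports.**  A diagonally invariant `f` over `ℂ` with a value derivation
(any length) each of whose values is fixed by the pointwise stabiliser of at most `k` indices has a
square-symmetric circuit — reduced, hence rigid — of orbit size `≤ (n+1)^(2k+4)`: the support theorem's
easy direction in ORBIT currency, for arbitrary computations. [folklore] -/
theorem qpOrbit_of_supportedDerivation {n k : ℕ} (𝒟 : ValueDerivation ℂ (Fin n × Fin n))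
    {f : MvPolynomial (Fin n × Fin n) ℂ} (hf : f ∈ 𝒟.S) (hfix : ∀ σ : Equiv.Perm (Fin n), ren σ f = f)
    (hsupp : ∀ q ∈ 𝒟.S, ∃ T : Finset (Fin n), T.card ≤ k ∧
      ∀ σ : Equiv.Perm (Fin n), (∀ i ∈ T, σ i = i) → ren σ q = q) :
    ∃ (G : Type) (_ : Fintype G) (C : LabelledArithCircuit ℂ (Fin n × Fin n) Unit G),
      C.IsSymmetric (Equiv.Perm (Fin n)) ∧ C.eval (C.output ()) = f ∧
        C.orbitSize (Equiv.Perm (Fin n)) ≤ (n + 1) ^ (2 * k + 4) := by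
  set B := (n + 1) ^ (k + 2) with hB
  have hB1 : 1 ≤ B := Nat.one_le_pow _ _ (Nat.succ_pos n)
  have hX : ∀ x : Fin n × Fin n, (Set.range fun σ : Equiv.Perm (Fin n) => σ • x).ncard ≤ B := fun x => by
    refine (ncard_orbit_var_le n x).trans ?_
    calc n * n ≤ (n + 1) ^ 2 := by nlinarith
      _ ≤ (n + 1) ^ (k + 2) := Nat.pow_le_pow_right (Nat.succ_pos n) (by omega)
  have hS : ∀ q ∈ 𝒟.S, (Set.range fun σ : Equiv.Perm (Fin n) => ren σ q).ncard ≤ B := by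
    intro q hq
    obtain ⟨T, hTk, hT⟩ := hsupp q hq
    refine (orbit_bounded_of_supported hT).trans ?_
    exact Nat.pow_le_pow_right (Nat.succ_pos n) (by omega)
  obtain ⟨G, inst, C, hC, hev, horb⟩ := 𝒟.exists_symmetric_of_valueDerivation hf hB1 hfix hX hS
  refine ⟨G, inst, C, hC, hev, horb.trans (le_of_eq ?_)⟩
  rw [hB, ← pow_add]; ring_nf

/-! ### Calibration at the permanent -/

/-- The permanent is diagonally `Sym(Fin n)`-invariant (naturality of `perPoly` under the bijection `σ`).
[folklore] -/
theorem ren_perPoly (n : ℕ) (σ : Equiv.Perm (Fin n)) : ren σ (perPoly (Fin n) ℂ) = perPoly (Fin n) ℂ := by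
  have h := rename_perPoly_equiv (k := ℂ) (σ : Fin n ≃ Fin n)
  have hfun : (Prod.map σ σ : Fin n × Fin n → Fin n × Fin n) = fun x => σ • x := by
    funext x; rfl
  rw [hfun] at h
  exact h

/-- **Every computation of the permanent passes through values of large orbit.**  For every family of
value derivations `𝒟 n ∋ per_n` over `ℂ` (ordinary straight-line computations, of ANY length) and every
bound `B n ≥ n²` on the `Sym(Fin n)`-orbits (diagonal action) of all their values, `B` is not `2^{o(n)}`:
some `ε > 0` has `2^{ε n} ≤ B n` for infinitely many `n`.  From the value-orbit symmetrisation theorem and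
Dawar–Wilsenach's Theorem 7.1, PROVED in the tree (`DawarWilsenach2025_thm71_holds`).
[cite: DawarWilsenach2025, Thm. 7.1 (p. 18)] -/
theorem perPoly_valueOrbit_lb (𝒟 : ∀ n : ℕ, ValueDerivation ℂ (Fin n × Fin n)) (B : ℕ → ℕ)
    (hper : ∀ n, perPoly (Fin n) ℂ ∈ (𝒟 n).S) (hBn : ∀ n, n * n ≤ B n)
    (hS : ∀ n, ∀ q ∈ (𝒟 n).S, (Set.range fun σ : Equiv.Perm (Fin n) => ren σ q).ncard ≤ B n) :
    ∃ ε : ℝ, 0 < ε ∧ ∃ᶠ n : ℕ in atTop, (2 : ℝ) ^ (ε * n) ≤ (B n : ℝ) := by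
  -- symmetric circuits of orbit size `≤ (B n ⊔ 1)²` for every `n`
  have hex : ∀ n : ℕ, ∃ (G : Type) (_ : Fintype G) (C : LabelledArithCircuit ℂ (Fin n × Fin n) Unit G),
      C.IsSymmetric (Equiv.Perm (Fin n)) ∧ C.eval (C.output ()) = perPoly (Fin n) ℂ ∧
        C.orbitSize (Equiv.Perm (Fin n)) ≤ (B n ⊔ 1) * (B n ⊔ 1) := fun n =>
    (𝒟 n).exists_symmetric_of_valueDerivation (hper n) (le_sup_right : 1 ≤ B n ⊔ 1) (ren_perPoly n)
      (fun x => (ncard_orbit_var_le n x).trans ((hBn n).trans le_sup_left))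
      (fun q hq => (hS n q hq).trans le_sup_left)
  choose G inst C hC hev horb using hex
  obtain ⟨ε, hε, hfreq⟩ := DawarWilsenach2025_thm71_holds ℂ G C hC hev
  refine ⟨ε / 2, by positivity, ?_⟩
  refine (hfreq.and_eventually (eventually_ge_atTop 1)).mono fun n ⟨hn, hn1⟩ => ?_
  have hB1 : B n ⊔ 1 = B n := sup_eq_left.2 ((Nat.one_le_iff_ne_zero.2 (by positivity)).trans (hBn n) |>.trans' (by nlinarith))
  have h2 : (2 : ℝ) ^ (ε * n) ≤ ((B n : ℝ)) ^ 2 := by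
    refine hn.trans ?_
    have := horb n
    rw [hB1] at this
    exact_mod_cast (by nlinarith [this] : (C n).orbitSize (Equiv.Perm (Fin n)) ≤ B n ^ 2)
  have hsq : ((2 : ℝ) ^ (ε / 2 * n)) ^ 2 = (2 : ℝ) ^ (ε * n) := by
    rw [← Real.rpow_natCast, ← Real.rpow_mul (by norm_num)]
    congr 1; push_cast; ring
  exact le_of_pow_le_pow_left₀ two_ne_zero (Nat.cast_nonneg _) (hsq ▸ h2)

end ValueOrbit

end Summit.ValiantsHypothesis.ValiantsHypothesis.Theorems

end
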